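import Literature.AlgebraicGeometry.ModuliOfAbelianVarieties.SiegelPrincipalLevelArithmeticGroup
import HarnessLib

/-!
# Integral symplectic similitudes with coprime inverse denominators: `ν ∈ ℕ⁺` and `ν·γ⁻¹ ∈ M_{2g}(ℤ)`

Topic `AlgebraicGeometry/ModuliOfAbelianVarieties`; namespace `Literature.AlgebraicGeometry.ModuliOfAbelianVarieties`.
THEOREMS ONLY (no definition, no named fact, no instance, no notation, no `sorry`; net Literature debt 0).
Cell hodgecm-mathlib (D-0151), E-road / HECKE-LINK line for `stub_noThinPiece` (B-plan1 (g14) line card v1.1), brick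
H2c «LACK-2» (B-p03 (g15) census `CENSUS-H2c-HasTypeLattice`; B-plan1 rulings 19:13:00Z (2) / 19:38:16Z (2)):
the ONE piece of integer bookkeeping of the Hecke kernel that survives the `ℓ`-adic choice of the Hecke move.

## The mathematics

Let `E_δ` be the alternating form of type `δ = (δ₁ | ⋯ | δ_g)` on `L = ℤ^{2g}` (★ `typeForm δ`, Gram matrix
`(0 Δ; −Δ 0)`, `Δ = diag(δᵢ)`), and let `γ ∈ M_{2g}(ℤ) ∩ GL_{2g}(ℚ)` be a RATIONAL SIMILITUDE of `E_δ`: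
`ᵗγ E_δ γ = ν E_δ` with `ν ∈ ℚ`.  Then:

* `ν` is an INTEGER (`exists_int_eq_multiplier_of_typeForm_similitude`): `E_δ = δ₁ E_{δ/δ₁}` (★ `typeForm_eq_smul_typeForm_div`)
  and the `(λ₁, μ₁)` entry of the integer matrix `ᵗγ E_{δ/δ₁} γ` is `ν · 1`;
* `(∏ δᵢ) · ν · γ⁻¹` is an INTEGER matrix (`exists_intMatrix_prod_mul_multiplier_smul_inv`): with the integer «adjugate»
  `E′ := (0 −Δ′; Δ′ 0)`, `Δ′ = diag(∏_{j} δⱼ / δᵢ)`, one has `E_δ E′ = E′ E_δ = (∏ δᵢ) · 1`, and `ᵗγ E_δ γ = ν E_δ` gives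
  `E′ ᵗγ E_δ = ν E′ E_δ γ⁻¹ = (∏ δᵢ) ν γ⁻¹`;
* hence, if moreover `m · γ⁻¹ ∈ M_{2g}(ℤ)` for a natural number `m` COPRIME to every `δᵢ`, then `ν · γ⁻¹ ∈ M_{2g}(ℤ)`
  (`forall_exists_int_eq_multiplier_mul_inv_of_coprime`, Bézout), and `ν ∈ ℕ⁺` when `ν > 0`
  (`exists_nat_eq_multiplier_of_typeForm_similitude`); in lattice words `ν · γ⁻¹ ℤ^{2g} ⊆ ℤ^{2g}`
  (`forall_exists_int_eq_multiplier_smul_inv_mulVec`): the Hecke kernel `K₀ = γ⁻¹ℤ^{2g}/ℤ^{2g}` is killed by the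
  multiplier `ν` itself, so the polarisation descends AT `ν` with type exactly `δ` ([MumfordAV1970] §23 Thm. 2: descent of a
  polarisation through a finite subgroup; [Lange2023AbelianVarietiesComplex] §2.7 Prop. 2.7.2 / Cor. 2.7.3; the type count
  `(L₁, νE_δ) ≅_γ (L, E_δ)` is ★ `Kaehler.ComplexTorus.IsPolarizationType.of_similitude`).

This is the arithmetic behind the Hecke correspondence `T(γ)` between Siegel moduli spaces of the SAME type `δ` at levels
`N` and `N·m` with `m` prime to `∏ δᵢ` ([MumfordFogartyKirwan1994] Ch. 7 §3 Lemma 7.11 (p. 140), the finite morphisms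
`𝒜_{g,d,nm} → 𝒜_{g,d,n}`; [Milne2005ShimuraVarieties] §5 p. 58, the maps `T(g) : Sh_K → Sh_{g⁻¹Kg}` and Def. 5.14, and §6
pp. 74–75): for such `m` the similitude factor `ν` and the denominator of `γ⁻¹` coincide up to
units, so the quotient by `K₀` needs no further division of the polarisation.  Consumers (HOME texts of the cell, not imported
here): B-p14 (g14)'s `QuotientAdapted` (QA1 `γ ℤ^{2g} ⊆ ℤ^{2g}`, QA2 `m γ⁻¹ ℤ^{2g} ⊆ ℤ^{2g}`, QA3 the similitude), B-p20 (g9)'s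
`Polarization.quotientBy` (descend at `n := ν`), B-p13 (g16)'s (L3).

Integrality of a rational matrix / number is phrased as in ★ `Adeles.mem_latticeOfGL_one_iff` (`∃ z : ℤ, (z : ℚ) = _`).
HC_CM is proved only modulo the 7 printed citations until rung 0 closes; this file discharges none of them.

## References
* [MumfordAV1970] D. Mumford, *Abelian Varieties* (1970), §23 Thm. 2 (p. 231) (descent of polarisations), §7 Thm. 4.
* [Lange2023AbelianVarietiesComplex] H. Lange, *Abelian Varieties over the Complex Numbers* (2023), §1.5.1 (type of a
  polarisation, p. 46), §2.7 Prop. 2.7.2 and Cor. 2.7.3 (isogenies and descended polarisations).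
* [MumfordFogartyKirwan1994] D. Mumford, J. Fogarty, F. Kirwan, *Geometric Invariant Theory*, 3rd ed. (1994), Ch. 7 §3
  Lemma 7.11 (p. 140) (the finite morphisms `𝒜_{g,d,nm} → 𝒜_{g,d,n}`), App. 7A (pp. 234–235).
* [Milne2005ShimuraVarieties] J. S. Milne, *Introduction to Shimura varieties* (2005), §5 p. 58 (the maps `T(g)`, Def. 5.14),
  §6 pp. 67–70 (`GSp`, the multiplier), Thm. 6.11 pp. 74–75.
* [GenestierNgo2020] A. Genestier, B. C. Ngô, *Lectures on Shimura varieties*, §1.2 (symplectic basis of type `D`).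
-/

set_option autoImplicit false

noncomputable section

open Matrix

namespace Literature.AlgebraicGeometry.ModuliOfAbelianVarieties

variable {g : ℕ} {δ : Fin g → ℕ}

/-! ### §1 Entrywise-integral rational matrices (bookkeeping in the `∃ z : ℤ, (z : ℚ) = _` currency) -/

/-- An entrywise-integral rational matrix IS the cast of an integer matrix (lattice bookkeeping, `Λ = γℤⁿ`).
[cite: Milne2005ShimuraVarieties, §4 pp. 48–49 (lattices)] -/
theorem exists_intMatrix_map_eq_of_forall_exists_int_eq {m n : Type*} {A : Matrix m n ℚ}
    (hA : ∀ i j, ∃ z : ℤ, (z : ℚ) = A i j) : ∃ B : Matrix m n ℤ, B.map (Int.castRingHom ℚ) = A := by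
  choose B hB using hA
  refine ⟨Matrix.of fun i j => B i j, ?_⟩
  ext i j
  rw [Matrix.map_apply, Matrix.of_apply, eq_intCast]
  exact hB i j

/-- The cast of an integer matrix is entrywise integral. [cite: Milne2005ShimuraVarieties, §4 pp. 48–49 (lattices)] -/
theorem forall_exists_int_eq_map_intCast {m n : Type*} (B : Matrix m n ℤ) :
    ∀ i j, ∃ z : ℤ, (z : ℚ) = B.map (Int.castRingHom ℚ) i j :=
  fun i j => ⟨B i j, by rw [Matrix.map_apply, eq_intCast]⟩

/-- An entrywise-integral matrix maps integral vectors to integral vectors (`γ ℤⁿ ⊆ ℤᵐ`).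
[cite: Milne2005ShimuraVarieties, §4 pp. 48–49 (lattices)] -/
theorem forall_exists_int_eq_mulVec_of_forall_exists_int_eq {m n : Type*} [Fintype n] {A : Matrix m n ℚ}
    (hA : ∀ i j, ∃ z : ℤ, (z : ℚ) = A i j) {v : n → ℚ} (hv : ∀ j, ∃ z : ℤ, (z : ℚ) = v j) :
    ∀ i, ∃ z : ℤ, (z : ℚ) = (A *ᵥ v) i := by
  choose B hB using hA
  choose w hw using hv
  intro i
  refine ⟨∑ j, B i j * w j, ?_⟩
  rw [Matrix.mulVec, dotProduct]
  push_cast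
  exact Finset.sum_congr rfl fun j _ => by rw [hB i j, hw j]

/-- Conversely, a rational matrix mapping integral vectors to integral vectors (`γ ℤⁿ ⊆ ℤᵐ`) is entrywise integral (test on
the standard basis). [cite: Milne2005ShimuraVarieties, §4 pp. 48–49 (lattices)] -/
theorem forall_exists_int_eq_of_forall_mulVec {m n : Type*} [Fintype n] [DecidableEq n] {A : Matrix m n ℚ}
    (hA : ∀ v : n → ℚ, (∀ j, ∃ z : ℤ, (z : ℚ) = v j) → ∀ i, ∃ z : ℤ, (z : ℚ) = (A *ᵥ v) i) :
    ∀ i j, ∃ z : ℤ, (z : ℚ) = A i j := by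
  intro i j
  have h := hA (Pi.single j 1) (fun k => by
    by_cases hk : k = j
    · subst hk; exact ⟨1, by simp⟩
    · exact ⟨0, by simp [hk]⟩) i
  simpa [Matrix.mulVec_single] using h

/-! ### §2 The integer «adjugate» of `E_δ` and the identity `(∏ δ) ν γ⁻¹ = E′ ᵗγ E_δ` -/

section Similitude

variable (δ)

/-- `E_δ · E′ = (∏ δᵢ) · 1` for the integer matrix `E′ = (0 −Δ′; Δ′ 0)`, `Δ′ = diag(∏ⱼ δⱼ / δᵢ)` (`δᵢ ∣ ∏ⱼ δⱼ`; no
positivity needed).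
[cite: GenestierNgo2020, §1.2 (symplectic basis of type D)] -/
theorem typeForm_mul_adjugateBlocks :
    typeForm δ *
        Matrix.fromBlocks 0 (-Matrix.diagonal fun i => (((∏ j, δ j) / δ i : ℕ) : ℤ))
          (Matrix.diagonal fun i => (((∏ j, δ j) / δ i : ℕ) : ℤ)) 0 =
      ((∏ j, δ j : ℕ) : ℤ) • (1 : Matrix (Fin g ⊕ Fin g) (Fin g ⊕ Fin g) ℤ) := by
  have hdiv : ∀ i, δ i * ((∏ j, δ j) / δ i) = ∏ j, δ j := fun i =>
    Nat.mul_div_cancel' (Finset.dvd_prod_of_mem δ (Finset.mem_univ i))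
  have hd : (Matrix.diagonal fun i => (δ i : ℤ)) * (Matrix.diagonal fun i => (((∏ j, δ j) / δ i : ℕ) : ℤ)) =
      ((∏ j, δ j : ℕ) : ℤ) • (1 : Matrix (Fin g) (Fin g) ℤ) := by
    rw [Matrix.diagonal_mul_diagonal, Matrix.smul_one_eq_diagonal]
    congr 1
    funext i
    rw [← Nat.cast_mul, hdiv i]
  rw [typeForm, Matrix.fromBlocks_multiply]
  simp only [Matrix.zero_mul, Matrix.mul_zero, zero_add, add_zero, Matrix.mul_neg, Matrix.neg_mul, neg_neg, hd,
    neg_zero]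
  rw [← Matrix.fromBlocks_one, Matrix.fromBlocks_smul, smul_zero]

/-- `E′ · E_δ = (∏ δᵢ) · 1` (the same integer «adjugate» on the left). [cite: GenestierNgo2020, §1.2 (symplectic basis of type D)] -/
theorem adjugateBlocks_mul_typeForm :
    Matrix.fromBlocks 0 (-Matrix.diagonal fun i => (((∏ j, δ j) / δ i : ℕ) : ℤ))
          (Matrix.diagonal fun i => (((∏ j, δ j) / δ i : ℕ) : ℤ)) 0 * typeForm δ =
      ((∏ j, δ j : ℕ) : ℤ) • (1 : Matrix (Fin g ⊕ Fin g) (Fin g ⊕ Fin g) ℤ) := by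
  have hdiv : ∀ i, ((∏ j, δ j) / δ i) * δ i = ∏ j, δ j := fun i =>
    Nat.div_mul_cancel (Finset.dvd_prod_of_mem δ (Finset.mem_univ i))
  have hd : (Matrix.diagonal fun i => (((∏ j, δ j) / δ i : ℕ) : ℤ)) * (Matrix.diagonal fun i => (δ i : ℤ)) =
      ((∏ j, δ j : ℕ) : ℤ) • (1 : Matrix (Fin g) (Fin g) ℤ) := by
    rw [Matrix.diagonal_mul_diagonal, Matrix.smul_one_eq_diagonal]
    congr 1
    funext i
    rw [← Nat.cast_mul, hdiv i]
  rw [typeForm, Matrix.fromBlocks_multiply]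
  simp only [Matrix.zero_mul, Matrix.mul_zero, zero_add, add_zero, Matrix.mul_neg, Matrix.neg_mul, neg_neg, hd,
    neg_zero]
  rw [← Matrix.fromBlocks_one, Matrix.fromBlocks_smul, smul_zero]

variable {δ}

/-- Casting `(c : ℤ) • 1` to `ℚ`. [folklore] -/
private theorem map_intCast_smul_one {n : Type*} [DecidableEq n] (c : ℕ) :
    (((c : ℕ) : ℤ) • (1 : Matrix n n ℤ)).map (Int.castRingHom ℚ) = (c : ℚ) • (1 : Matrix n n ℚ) := by
  ext i j
  rw [Matrix.map_apply, Matrix.smul_apply, Matrix.smul_apply, Matrix.one_apply, Matrix.one_apply]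
  split_ifs <;> simp

/-- **`(∏ δᵢ) · ν · γ⁻¹` is an integer matrix** for an integral rational similitude `γ` of `E_δ` (`ᵗγ E_δ γ = ν E_δ`):
`(∏ δᵢ) ν γ⁻¹ = E′ ᵗγ E_δ` with the integer adjugate `E′` of `typeForm_mul_adjugateBlocks`.
[cite: Milne2005ShimuraVarieties, §6 pp. 67–70 (GSp and its multiplier)] [cite: MumfordAV1970, §23 Thm. 2 (p. 231)] -/
theorem exists_intMatrix_prod_mul_multiplier_smul_inv (γ : GL (Fin g ⊕ Fin g) ℚ)
    (hγ : ∀ i j, ∃ z : ℤ, (z : ℚ) = (γ : Matrix (Fin g ⊕ Fin g) (Fin g ⊕ Fin g) ℚ) i j) {ν : ℚ}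
    (hsim : (γ : Matrix (Fin g ⊕ Fin g) (Fin g ⊕ Fin g) ℚ)ᵀ * typeFormOver δ ℚ *
        (γ : Matrix (Fin g ⊕ Fin g) (Fin g ⊕ Fin g) ℚ) = ν • typeFormOver δ ℚ) :
    ∃ B : Matrix (Fin g ⊕ Fin g) (Fin g ⊕ Fin g) ℤ,
      B.map (Int.castRingHom ℚ) =
        (((∏ j, δ j : ℕ) : ℚ) * ν) • ((γ⁻¹ : GL (Fin g ⊕ Fin g) ℚ) : Matrix (Fin g ⊕ Fin g) (Fin g ⊕ Fin g) ℚ) := by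
  obtain ⟨Γ, hΓ⟩ := exists_intMatrix_map_eq_of_forall_exists_int_eq hγ
  -- the integer adjugate `E′` and `E′ E = (∏ δ) • 1` over `ℚ`
  have hE'E : (Matrix.fromBlocks 0 (-Matrix.diagonal fun i => (((∏ j, δ j) / δ i : ℕ) : ℤ))
        (Matrix.diagonal fun i => (((∏ j, δ j) / δ i : ℕ) : ℤ)) 0).map (Int.castRingHom ℚ) * typeFormOver δ ℚ =
      ((∏ j, δ j : ℕ) : ℚ) • (1 : Matrix (Fin g ⊕ Fin g) (Fin g ⊕ Fin g) ℚ) := by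
    rw [typeFormOver, ← Matrix.map_mul, adjugateBlocks_mul_typeForm δ, map_intCast_smul_one]
  -- `γ γ⁻¹ = 1` and `ᵗγ E = ν • (E γ⁻¹)`
  have hγγ : (γ : Matrix (Fin g ⊕ Fin g) (Fin g ⊕ Fin g) ℚ) *
      ((γ⁻¹ : GL (Fin g ⊕ Fin g) ℚ) : Matrix (Fin g ⊕ Fin g) (Fin g ⊕ Fin g) ℚ) = 1 := by
    rw [← Units.val_mul, mul_inv_cancel, Units.val_one]
  have h1 : (γ : Matrix (Fin g ⊕ Fin g) (Fin g ⊕ Fin g) ℚ)ᵀ * typeFormOver δ ℚ =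
      ν • (typeFormOver δ ℚ * ((γ⁻¹ : GL (Fin g ⊕ Fin g) ℚ) : Matrix (Fin g ⊕ Fin g) (Fin g ⊕ Fin g) ℚ)) := by
    have h := congrArg (fun M => M * ((γ⁻¹ : GL (Fin g ⊕ Fin g) ℚ) : Matrix (Fin g ⊕ Fin g) (Fin g ⊕ Fin g) ℚ)) hsim
    simp only [Matrix.mul_assoc, hγγ, Matrix.mul_one, Matrix.smul_mul] at h
    simpa only [Matrix.mul_assoc] using h
  -- `E′ ᵗγ E = (∏ δ) ν γ⁻¹`
  refine ⟨Matrix.fromBlocks 0 (-Matrix.diagonal fun i => (((∏ j, δ j) / δ i : ℕ) : ℤ))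
      (Matrix.diagonal fun i => (((∏ j, δ j) / δ i : ℕ) : ℤ)) 0 * Γᵀ * typeForm δ, ?_⟩
  rw [Matrix.map_mul, Matrix.map_mul, Matrix.transpose_map, hΓ]
  rw [show (typeForm δ).map (Int.castRingHom ℚ) = typeFormOver δ ℚ from rfl]
  rw [Matrix.mul_assoc, h1, Matrix.mul_smul, ← Matrix.mul_assoc, hE'E, Matrix.smul_mul, Matrix.one_mul, smul_smul,
    mul_comm ν]

/-- **The multiplier of an integral similitude of `E_δ` is an INTEGER** (`δ` a polarisation type, `0 < g`): read the
`(λ₁, μ₁)` entry of `ᵗγ E_{δ/δ₁} γ = ν E_{δ/δ₁}`, which is `ν · 1`. [cite: Milne2005ShimuraVarieties, §6 pp. 67–70 (the multiplier)]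
[cite: GenestierNgo2020, §1.2 (type D = (d₁ | ⋯ | d_g))] -/
theorem exists_int_eq_multiplier_of_typeForm_similitude (hδ : IsPolarizationType δ) (hg : 0 < g)
    (γ : Matrix (Fin g ⊕ Fin g) (Fin g ⊕ Fin g) ℚ) (hγ : ∀ i j, ∃ z : ℤ, (z : ℚ) = γ i j) {ν : ℚ}
    (hsim : γᵀ * typeFormOver δ ℚ * γ = ν • typeFormOver δ ℚ) : ∃ n : ℤ, (n : ℚ) = ν := by
  obtain ⟨Γ, rfl⟩ := exists_intMatrix_map_eq_of_forall_exists_int_eq hγ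
  have hδ₀ : (δ ⟨0, hg⟩ : ℚ) ≠ 0 := by exact_mod_cast (hδ.1 ⟨0, hg⟩).ne'
  -- `E_δ = δ₀ • E_{δ′}` over `ℚ`, `δ′ = δ/δ₀`
  have hE : typeFormOver δ ℚ = (δ ⟨0, hg⟩ : ℚ) • typeFormOver (fun i => δ i / δ ⟨0, hg⟩) ℚ := by
    rw [typeFormOver, typeFormOver, typeForm_eq_smul_typeForm_div hδ hg]
    ext i j
    rw [Matrix.map_apply, Matrix.smul_apply, Matrix.smul_apply, Matrix.map_apply, smul_eq_mul, smul_eq_mul,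
      map_mul, map_natCast]
  -- cancel `δ₀`
  have hsim' : (Γ.map (Int.castRingHom ℚ))ᵀ * typeFormOver (fun i => δ i / δ ⟨0, hg⟩) ℚ * Γ.map (Int.castRingHom ℚ) =
      ν • typeFormOver (fun i => δ i / δ ⟨0, hg⟩) ℚ := by
    rw [hE, Matrix.mul_smul, Matrix.smul_mul, smul_comm] at hsim
    exact smul_right_injective _ hδ₀ hsim
  -- the `(λ₀, μ₀)` entry
  have hentry := congrArg (fun M : Matrix (Fin g ⊕ Fin g) (Fin g ⊕ Fin g) ℚ => M (Sum.inl ⟨0, hg⟩) (Sum.inr ⟨0, hg⟩))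
    hsim'
  have hone : typeFormOver (fun i => δ i / δ ⟨0, hg⟩) ℚ (Sum.inl ⟨0, hg⟩) (Sum.inr ⟨0, hg⟩) = 1 := by
    rw [typeFormOver_apply, typeForm, Matrix.fromBlocks_apply₁₂, Matrix.diagonal_apply_eq, Nat.div_self (hδ.1 ⟨0, hg⟩)]
    simp
  simp only [Matrix.smul_apply, hone, smul_eq_mul, mul_one] at hentry
  -- the left-hand side is an integer
  refine ⟨(Γᵀ * typeForm (fun i => δ i / δ ⟨0, hg⟩) * Γ) (Sum.inl ⟨0, hg⟩) (Sum.inr ⟨0, hg⟩), ?_⟩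
  rw [← hentry, typeFormOver, ← Matrix.transpose_map, ← Matrix.map_mul, ← Matrix.map_mul, Matrix.map_apply,
    eq_intCast]

/-- **A POSITIVE multiplier of an integral similitude of `E_δ` is a positive natural number.**
[cite: Milne2005ShimuraVarieties, §6 pp. 67–70 (the multiplier)] -/
theorem exists_nat_eq_multiplier_of_typeForm_similitude (hδ : IsPolarizationType δ) (hg : 0 < g)
    (γ : Matrix (Fin g ⊕ Fin g) (Fin g ⊕ Fin g) ℚ) (hγ : ∀ i j, ∃ z : ℤ, (z : ℚ) = γ i j) {ν : ℚ} (hν : 0 < ν)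
    (hsim : γᵀ * typeFormOver δ ℚ * γ = ν • typeFormOver δ ℚ) : ∃ n : ℕ, 0 < n ∧ (n : ℚ) = ν := by
  obtain ⟨z, hz⟩ := exists_int_eq_multiplier_of_typeForm_similitude hδ hg γ hγ hsim
  have hz0 : (0 : ℚ) < (z : ℚ) := hz ▸ hν
  have hz0' : 0 < z := by exact_mod_cast hz0
  refine ⟨z.toNat, by omega, ?_⟩
  rw [← hz]
  exact_mod_cast Int.toNat_of_nonneg hz0'.le

/-! ### §3 Coprime denominators: `ν · γ⁻¹ ∈ M_{2g}(ℤ)` -/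

/-- Bézout bookkeeping: if `a · x` and `b · x` are integers for coprime naturals `a, b`, then `x` is an integer. [folklore] -/
private theorem exists_int_eq_of_coprime_mul {a b : ℕ} (hab : Nat.Coprime a b) {x : ℚ}
    (ha : ∃ z : ℤ, (z : ℚ) = (a : ℚ) * x) (hb : ∃ z : ℤ, (z : ℚ) = (b : ℚ) * x) : ∃ z : ℤ, (z : ℚ) = x := by
  obtain ⟨za, hza⟩ := ha
  obtain ⟨zb, hzb⟩ := hb
  -- `u a + v b = 1` over `ℤ`
  have huv : (a : ℤ) * Nat.gcdA a b + (b : ℤ) * Nat.gcdB a b = 1 := by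
    rw [← Nat.gcd_eq_gcd_ab a b, Nat.Coprime.gcd_eq_one hab, Nat.cast_one]
  refine ⟨Nat.gcdA a b * za + Nat.gcdB a b * zb, ?_⟩
  have huvQ : (a : ℚ) * (Nat.gcdA a b : ℚ) + (b : ℚ) * (Nat.gcdB a b : ℚ) = 1 := by exact_mod_cast huv
  push_cast
  rw [hza, hzb]
  linear_combination x * huvQ

/-- **MAIN LEMMA (Hecke kernel killed by the multiplier).**  Let `γ` be an integral rational similitude of `E_δ`
(`γ ∈ M_{2g}(ℤ)`, `ᵗγ E_δ γ = ν E_δ`) such that `m · γ⁻¹ ∈ M_{2g}(ℤ)` for a natural number `m` coprime to every `δᵢ`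
(`δ` a polarisation type, `0 < g`).  Then `ν · γ⁻¹ ∈ M_{2g}(ℤ)`: the quotient lattice `γ⁻¹ℤ^{2g} ⊇ ℤ^{2g}` satisfies
`ν · γ⁻¹ℤ^{2g} ⊆ ℤ^{2g}`, i.e. the Hecke kernel `K₀ = γ⁻¹ℤ^{2g}/ℤ^{2g}` is `ν`-torsion, and the polarisation of type `δ`
descends through `K₀` at the multiplier `ν` ([MumfordAV1970] §23 Thm. 2) with type `δ` again.  Proof: `(∏ δᵢ) ν γ⁻¹` and
`m ν γ⁻¹ = ν (m γ⁻¹)` are integral (`ν ∈ ℤ`), and `gcd(m, ∏ δᵢ) = 1`.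
[cite: MumfordAV1970, §23 Thm. 2 (p. 231)]
[cite: Milne2005ShimuraVarieties, §5 p. 58 (the maps T(g) : Sh_K → Sh_{g⁻¹Kg} and Def. 5.14) and §6 pp. 74–75]
[cite: MumfordFogartyKirwan1994, Ch. 7 §3 Lemma 7.11 (p. 140) (the finite morphisms 𝒜_{g,d,nm} → 𝒜_{g,d,n})] -/
theorem forall_exists_int_eq_multiplier_mul_inv_of_coprime (hδ : IsPolarizationType δ) (hg : 0 < g)
    (γ : GL (Fin g ⊕ Fin g) ℚ) (hγ : ∀ i j, ∃ z : ℤ, (z : ℚ) = (γ : Matrix (Fin g ⊕ Fin g) (Fin g ⊕ Fin g) ℚ) i j)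
    {ν : ℚ} (hsim : (γ : Matrix (Fin g ⊕ Fin g) (Fin g ⊕ Fin g) ℚ)ᵀ * typeFormOver δ ℚ *
        (γ : Matrix (Fin g ⊕ Fin g) (Fin g ⊕ Fin g) ℚ) = ν • typeFormOver δ ℚ)
    {m : ℕ} (hm : ∀ i j, ∃ z : ℤ, (z : ℚ) =
        (m : ℚ) * ((γ⁻¹ : GL (Fin g ⊕ Fin g) ℚ) : Matrix (Fin g ⊕ Fin g) (Fin g ⊕ Fin g) ℚ) i j)
    (hcop : ∀ i, Nat.Coprime m (δ i)) :
    ∀ i j, ∃ z : ℤ, (z : ℚ) = ν * ((γ⁻¹ : GL (Fin g ⊕ Fin g) ℚ) : Matrix (Fin g ⊕ Fin g) (Fin g ⊕ Fin g) ℚ) i j := by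
  obtain ⟨n, hn⟩ := exists_int_eq_multiplier_of_typeForm_similitude hδ hg _ hγ hsim
  obtain ⟨B, hB⟩ := exists_intMatrix_prod_mul_multiplier_smul_inv γ hγ hsim
  have hcopP : Nat.Coprime m (∏ j, δ j) := Nat.Coprime.prod_right fun i _ => hcop i
  intro i j
  refine exists_int_eq_of_coprime_mul hcopP ?_ ?_
  · -- `m · (ν γ⁻¹)ᵢⱼ = ν · (m γ⁻¹)ᵢⱼ`
    obtain ⟨z, hz⟩ := hm i j
    refine ⟨n * z, ?_⟩
    rw [Int.cast_mul, hz, hn]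
    ring
  · -- `(∏ δ) · (ν γ⁻¹)ᵢⱼ` is the `(i, j)` entry of the integer matrix `B`
    refine ⟨B i j, ?_⟩
    have h := congrArg (fun M : Matrix (Fin g ⊕ Fin g) (Fin g ⊕ Fin g) ℚ => M i j) hB
    simp only [Matrix.map_apply, Matrix.smul_apply, smul_eq_mul, eq_intCast] at h
    rw [h]
    ring

/-- **Lattice form of the main lemma: `ν · γ⁻¹ ℤ^{2g} ⊆ ℤ^{2g}`** — every integral vector `w` has `ν · γ⁻¹ w` integral
(so `QA2` of the cell's `QuotientAdapted` also holds with `N′ := N · ν`, and `K₀ ⊆ A[ν]`).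
[cite: MumfordAV1970, §23 Thm. 2 (p. 231)] [cite: Milne2005ShimuraVarieties, §6 pp. 74–75] -/
theorem forall_exists_int_eq_multiplier_smul_inv_mulVec (hδ : IsPolarizationType δ) (hg : 0 < g)
    (γ : GL (Fin g ⊕ Fin g) ℚ) (hγ : ∀ i j, ∃ z : ℤ, (z : ℚ) = (γ : Matrix (Fin g ⊕ Fin g) (Fin g ⊕ Fin g) ℚ) i j)
    {ν : ℚ} (hsim : (γ : Matrix (Fin g ⊕ Fin g) (Fin g ⊕ Fin g) ℚ)ᵀ * typeFormOver δ ℚ *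
        (γ : Matrix (Fin g ⊕ Fin g) (Fin g ⊕ Fin g) ℚ) = ν • typeFormOver δ ℚ)
    {m : ℕ} (hm : ∀ i j, ∃ z : ℤ, (z : ℚ) =
        (m : ℚ) * ((γ⁻¹ : GL (Fin g ⊕ Fin g) ℚ) : Matrix (Fin g ⊕ Fin g) (Fin g ⊕ Fin g) ℚ) i j)
    (hcop : ∀ i, Nat.Coprime m (δ i)) {w : Fin g ⊕ Fin g → ℚ} (hw : ∀ j, ∃ z : ℤ, (z : ℚ) = w j) :
    ∀ i, ∃ z : ℤ, (z : ℚ) =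
      (ν • (((γ⁻¹ : GL (Fin g ⊕ Fin g) ℚ) : Matrix (Fin g ⊕ Fin g) (Fin g ⊕ Fin g) ℚ) *ᵥ w)) i := by
  have hA : ∀ i j, ∃ z : ℤ, (z : ℚ) =
      (ν • ((γ⁻¹ : GL (Fin g ⊕ Fin g) ℚ) : Matrix (Fin g ⊕ Fin g) (Fin g ⊕ Fin g) ℚ)) i j := by
    intro i j
    rw [Matrix.smul_apply, smul_eq_mul]
    exact forall_exists_int_eq_multiplier_mul_inv_of_coprime hδ hg γ hγ hsim hm hcop i j
  intro i
  obtain ⟨z, hz⟩ := forall_exists_int_eq_mulVec_of_forall_exists_int_eq hA hw i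
  exact ⟨z, by rw [hz, Matrix.smul_mulVec]⟩

end Similitude

end Literature.AlgebraicGeometry.ModuliOfAbelianVarieties

end
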